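/-
Copyright (c) 2026 the pub-hodgecm-mathlib formalisation cell (harness21).  Prover seat hodgecm-mathlib-K2E3-p17 (g8), Track B «K2-LIT» / h413
(`stmt-HodgeConjecture-24833`), line `K2_E3_EllipticInputs`, leaf (nsc-S-A'), D94 brick IRR''-b2 (CENSUS v0.2 §7): an `{X²}`-piece has an irreducible constituent with
`E = {X²}`.  2026-09-04.
-/
import Summits.HodgeConjecture.HodgeConjecture.Theorems.K2E3GL3OneLinkNestedHighPieces                  -- ★ IRR″-a (this seat): letters, `tch_X_ne_Y`, `isOpen_ker_b`
import Summits.HodgeConjecture.HodgeConjecture.Theorems.K2E3GL3ExponentRules                            -- ★ H0 (K2E3-p25): `even_finrank_weightSpace₁₂`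
import Summits.HodgeConjecture.HodgeConjecture.Theorems.K2E3GL2UnlinkedIrreducible                      -- ★ GL2-UNL (K2E3-p11): `isIrreducible_parabolicIndGL_two_self`
import Summits.HodgeConjecture.HodgeConjecture.Theorems.K2E3GL3JacquetMultiplicityAdditive              -- ★ ADD (this seat)
import Summits.HodgeConjecture.HodgeConjecture.Theorems.K2E3GL3PrincipalSeriesExhaustion                -- ★ EXH (K2E3-p24) (pattern of `exists_finrank_weightSpace_ne_zero_of_constituents`)
import Literature.NumberTheory.Automorphic.IrreducibleClassesConstituents                               -- ★ `IrrClass.exists_isConstituentOf`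
import HarnessLib

/-!
# Crux `H413` — leaf (nsc-S-A′), brick IRR″-b2: AN `{X²}`-PIECE HAS AN IRREDUCIBLE CONSTITUENT `ω` WITH `E(ω) = {X²}`

Cell `hodgecm-mathlib`, Track B; THEOREMS ONLY; count-neutral helper (`--supports stmt-HodgeConjecture-24833 --as helper`).  Letters as in ★ IRR″-a and IRR″-b.  For ANY smooth `V` on
`GL₃(F)` with finite-dimensional `r_B V`, all of whose constituents have `r_B ≠ 0` (`hJ`, e.g. ★ IRR″-b `nontrivial_coinvariants_of_isConstituentOf_D_high` for the pieces
of `D″`), with `mult V X = 2` and no other weight (`X = tch(a,aν,aν)`, `aν = ην½`): **`exists_constituent_X_two`** — some irreducible constituent `ω` of `V` has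
`mult ω X = 2` and no other weight (a constituent exists, ★ `IrrClass.exists_isConstituentOf`; its weights are bounded by those of `V` through the subquotient, ★ ADD;
it has a weight, `hJ`; and `mult ω X` is even, ★ H0 with `I₂(aν,aν)` irreducible, ★ GL2-UNL).  Input of IRR″-c.

HONEST LABEL: HC_CM is proved only modulo the 7 printed citations (2 remaining named inputs: hLiu418 = stmt-HodgeConjecture-24832, h413 =
stmt-HodgeConjecture-24833) until rung 0 closes; count-neutral helper.

## References
* [BernsteinZelevinsky1977] I. N. Bernstein, A. V. Zelevinsky, *Induced representations of reductive p-adic groups I*, Ann. Sci. ÉNS 10 (1977), Prop. 1.9, Cor. 2.13, Thm. 2.9.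
* [Zelevinsky1980] A. V. Zelevinsky, *Induced representations of reductive p-adic groups II*, Ann. Sci. ÉNS 13 (1980), §1.6, Ex. 3.2.
-/

set_option autoImplicit false
-- the mandated namespace repeats `HodgeConjecture.HodgeConjecture`, as in every `Theorems/*.lean` of this sub-problem
set_option linter.dupNamespace false

noncomputable section

open Module Representation Literature.NumberTheory.Automorphic Literature.NumberTheory.Automorphic.Zelevinsky1980 Literature.NumberTheory.GaloisRepresentations.IsNonarchimedeanLocalField
open Literature.RepresentationTheory.FiniteGroups
open scoped MatrixGroups NNReal
open Summit.HodgeConjecture.HodgeConjecture.Cruxes.H413.K2E3GL3OneLinkNestedHighPieces (isOpen_ker_b)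
open Summit.HodgeConjecture.HodgeConjecture.Cruxes.H413.K2E3GL3ExponentRules (even_finrank_weightSpace₁₂)
open Summit.HodgeConjecture.HodgeConjecture.Cruxes.H413.K2E3GL2UnlinkedIrreducible (isIrreducible_parabolicIndGL_two_self)
open Summit.HodgeConjecture.HodgeConjecture.Cruxes.H413.K2E3GL2JacquetModuleStructure (continuous_unitsCoe_of_isOpen_ker)
open Summit.HodgeConjecture.HodgeConjecture.Cruxes.H413.K2E3GL3JacquetMultiplicityAdditive (finrank_weightSpace_subrepresentation_le finrank_weightSpace_quotientRep_le
  finiteDimensional_jacquet_subrepresentation finiteDimensional_jacquet_quotientRep finrank_weightSpace_eq_of_equiv finiteDimensional_jacquet_of_equiv)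
open Summit.HodgeConjecture.HodgeConjecture.Cruxes.H413.K2E3JacquetExponentMultiset (subsingleton_of_forall_weightSpace_eq_bot)

namespace Summit.HodgeConjecture.HodgeConjecture.Cruxes.H413.K2E3GL3OneLinkNestedHighConstituent

variable {F : Type} [Field F] [ValuativeRel F] [TopologicalSpace F] [IsNonarchimedeanLocalField F] (η : Fˣ →* ℂˣ)

set_option maxHeartbeats 1600000 in  -- one long bookkeeping proof over large weight terms (cumulative budget)
/-- **AN `{X²}`-PIECE HAS AN IRREDUCIBLE CONSTITUENT `ω` WITH `E(ω) = {X²}`.** [cite: BernsteinZelevinsky1977, Cor. 2.13, Thm. 2.9] [cite: Zelevinsky1980, §1.6, Ex. 3.2] -/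
theorem exists_constituent_X_two (hη : IsOpen ((η.ker : Subgroup Fˣ) : Set Fˣ))
    {Y : Type} [AddCommGroup Y] [Module ℂ Y] [Nontrivial Y] (V : Representation ℂ (GL (Fin 3) F) Y) (hV : V.IsSmooth)
    [FiniteDimensional ℂ (restrictUnipotentGL F (id : Fin 3 → Fin 3) V).Coinvariants]
    (hJ : ∀ r : SmoothIrrep (GL (Fin 3) F), (IrrClass.mk r).IsConstituentOf V → Nontrivial (restrictUnipotentGL F (id : Fin 3 → Fin 3) r.ρ).Coinvariants)
    (hX : finrank ℂ ↥(⨅ m, Module.End.maxGenEigenspace (Representation.normalizedJacquetGL F (id : Fin 3 → Fin 3) V m) (((∏ a : Fin 3, ((![(η * ((unramifiedTwist F (1 / 2) : QuasiChar F).toMonoidHom)⁻¹), (η * ((unramifiedTwist F (1 / 2) : QuasiChar F).toMonoidHom)), (η * ((unramifiedTwist F (1 / 2) : QuasiChar F).toMonoidHom))] : Fin 3 → (Fˣ →* ℂˣ)) a).comp (Matrix.GeneralLinearGroup.det.comp (Pi.evalMonoidHom (fun a : Fin 3 => GL {i : Fin 3 // (id : Fin 3 → Fin 3) i = a} F) a)))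 m : ℂˣ) : ℂ)) = 2)
    (h0 : ∀ ζ : (Π a : Fin 3, GL {i : Fin 3 // (id : Fin 3 → Fin 3) i = a} F) → ℂ, ζ ≠ (fun m : (Π a : Fin 3, GL {i : Fin 3 // (id : Fin 3 → Fin 3) i = a} F) => (((∏ a : Fin 3, ((![(η * ((unramifiedTwist F (1 / 2) : QuasiChar F).toMonoidHom)⁻¹), (η * ((unramifiedTwist F (1 / 2) : QuasiChar F).toMonoidHom)), (η * ((unramifiedTwist F (1 / 2) : QuasiChar F).toMonoidHom))] : Fin 3 → (Fˣ →* ℂˣ)) a).comp (Matrix.GeneralLinearGroup.det.comp (Pi.evalMonoidHom (fun a : Fin 3 => GL {i : Fin 3 // (id : Fin 3 → Fin 3) i = a} F) a))) m : ℂˣ) : ℂ)) → finrank ℂ ↥(⨅ m, Module.End.maxGenEigenspace (Representation.normalizedJacquetGL F (id : Fin 3 → Fin 3) V m) (ζ m)) = 0) :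
    ∃ r : SmoothIrrep (GL (Fin 3) F), (IrrClass.mk r).IsConstituentOf V ∧
      FiniteDimensional ℂ (restrictUnipotentGL F (id : Fin 3 → Fin 3) r.ρ).Coinvariants ∧
      finrank ℂ ↥(⨅ m, Module.End.maxGenEigenspace (Representation.normalizedJacquetGL F (id : Fin 3 → Fin 3) r.ρ m) (((∏ a : Fin 3, ((![(η * ((unramifiedTwist F (1 / 2) : QuasiChar F).toMonoidHom)⁻¹), (η * ((unramifiedTwist F (1 / 2) : QuasiChar F).toMonoidHom)), (η * ((unramifiedTwist F (1 / 2) : QuasiChar F).toMonoidHom))] : Fin 3 → (Fˣ →* ℂˣ)) a).comp (Matrix.GeneralLinearGroup.det.comp (Pi.evalMonoidHom (fun a : Fin 3 => GL {i : Fin 3 // (id : Fin 3 → Fin 3) i = a} F) a))) m : ℂˣ) : ℂ)) = 2 ∧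
      ∀ ζ : (Π a : Fin 3, GL {i : Fin 3 // (id : Fin 3 → Fin 3) i = a} F) → ℂ, ζ ≠ (fun m : (Π a : Fin 3, GL {i : Fin 3 // (id : Fin 3 → Fin 3) i = a} F) => (((∏ a : Fin 3, ((![(η * ((unramifiedTwist F (1 / 2) : QuasiChar F).toMonoidHom)⁻¹), (η * ((unramifiedTwist F (1 / 2) : QuasiChar F).toMonoidHom)), (η * ((unramifiedTwist F (1 / 2) : QuasiChar F).toMonoidHom))] : Fin 3 → (Fˣ →* ℂˣ)) a).comp (Matrix.GeneralLinearGroup.det.comp (Pi.evalMonoidHom (fun a : Fin 3 => GL {i : Fin 3 // (id : Fin 3 → Fin 3) i = a} F) a))) m : ℂˣ) : ℂ)) → finrank ℂ ↥(⨅ m, Module.End.maxGenEigenspace (Representation.normalizedJacquetGL F (id : Fin 3 → Fin 3) r.ρ m) (ζ m)) = 0 := by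
  obtain ⟨c, hc⟩ := IrrClass.exists_isConstituentOf V hV
  obtain ⟨r, -, N₁, N₂, hle, ⟨e⟩⟩ := hc
  have hr : (IrrClass.mk r).IsConstituentOf V := ⟨r, rfl, N₁, N₂, hle, ⟨e⟩⟩
  haveI hnt := hJ r hr
  let N₂' : Subrepresentation N₁.toRepresentation :=
    ⟨N₂.toSubmodule.comap N₁.toSubmodule.subtype, fun g _ hx => N₂.apply_mem_toSubmodule g hx⟩
  have e' : r.ρ.Equiv N₂'.quotientRep := e
  have hN₁s : N₁.toRepresentation.IsSmooth := hV.toRepresentation N₁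
  haveI : FiniteDimensional ℂ (restrictUnipotentGL F (id : Fin 3 → Fin 3) N₁.toRepresentation).Coinvariants :=
    finiteDimensional_jacquet_subrepresentation V monotone_id hV N₁
  haveI : FiniteDimensional ℂ (restrictUnipotentGL F (id : Fin 3 → Fin 3) N₂'.quotientRep).Coinvariants :=
    finiteDimensional_jacquet_quotientRep N₁.toRepresentation N₂'
  haveI hfdr : FiniteDimensional ℂ (restrictUnipotentGL F (id : Fin 3 → Fin 3) r.ρ).Coinvariants := finiteDimensional_jacquet_of_equiv _ _ e'.symm
  -- weights of `r` are bounded by those of `V`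
  have hle : ∀ ζ : (Π a : Fin 3, GL {i : Fin 3 // (id : Fin 3 → Fin 3) i = a} F) → ℂ, finrank ℂ ↥(⨅ m, Module.End.maxGenEigenspace (Representation.normalizedJacquetGL F (id : Fin 3 → Fin 3) r.ρ m) (ζ m)) ≤ finrank ℂ ↥(⨅ m, Module.End.maxGenEigenspace (Representation.normalizedJacquetGL F (id : Fin 3 → Fin 3) V m) (ζ m)) := fun ζ => by
    rw [finrank_weightSpace_eq_of_equiv _ _ e' ζ]
    exact (finrank_weightSpace_quotientRep_le N₁.toRepresentation hN₁s N₂' ζ).trans (finrank_weightSpace_subrepresentation_le V hV N₁ ζ)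
  have h0r : ∀ ζ : (Π a : Fin 3, GL {i : Fin 3 // (id : Fin 3 → Fin 3) i = a} F) → ℂ, ζ ≠ (fun m : (Π a : Fin 3, GL {i : Fin 3 // (id : Fin 3 → Fin 3) i = a} F) => (((∏ a : Fin 3, ((![(η * ((unramifiedTwist F (1 / 2) : QuasiChar F).toMonoidHom)⁻¹), (η * ((unramifiedTwist F (1 / 2) : QuasiChar F).toMonoidHom)), (η * ((unramifiedTwist F (1 / 2) : QuasiChar F).toMonoidHom))] : Fin 3 → (Fˣ →* ℂˣ)) a).comp (Matrix.GeneralLinearGroup.det.comp (Pi.evalMonoidHom (fun a : Fin 3 => GL {i : Fin 3 // (id : Fin 3 → Fin 3) i = a} F) a))) m : ℂˣ) : ℂ)) → finrank ℂ ↥(⨅ m, Module.End.maxGenEigenspace (Representation.normalizedJacquetGL F (id : Fin 3 → Fin 3) r.ρ m) (ζ m)) = 0 := fun ζ hζ => Nat.le_zero.1 ((hle ζ).trans (h0 ζ hζ).le)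
  refine ⟨r, hr, hfdr, ?_, h0r⟩
  -- `r` has a weight, necessarily `X`
  have hXr : finrank ℂ ↥(⨅ m, Module.End.maxGenEigenspace (Representation.normalizedJacquetGL F (id : Fin 3 → Fin 3) r.ρ m) (((∏ a : Fin 3, ((![(η * ((unramifiedTwist F (1 / 2) : QuasiChar F).toMonoidHom)⁻¹), (η * ((unramifiedTwist F (1 / 2) : QuasiChar F).toMonoidHom)), (η * ((unramifiedTwist F (1 / 2) : QuasiChar F).toMonoidHom))] : Fin 3 → (Fˣ →* ℂˣ)) a).comp (Matrix.GeneralLinearGroup.det.comp (Pi.evalMonoidHom (fun a : Fin 3 => GL {i : Fin 3 // (id : Fin 3 → Fin 3) i = a} F) a))) m : ℂˣ) : ℂ)) ≠ 0 := by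
    intro hz
    have hall : ∀ ζ : (Π a : Fin 3, GL {i : Fin 3 // (id : Fin 3 → Fin 3) i = a} F) → ℂ, (⨅ m, Module.End.maxGenEigenspace (normalizedJacquetGL F (id : Fin 3 → Fin 3) r.ρ m) (ζ m)) = ⊥ := by
      intro ζ
      apply Submodule.finrank_eq_zero.1
      by_cases hζ : ζ = (fun m : (Π a : Fin 3, GL {i : Fin 3 // (id : Fin 3 → Fin 3) i = a} F) => (((∏ a : Fin 3, ((![(η * ((unramifiedTwist F (1 / 2) : QuasiChar F).toMonoidHom)⁻¹), (η * ((unramifiedTwist F (1 / 2) : QuasiChar F).toMonoidHom)), (η * ((unramifiedTwist F (1 / 2) : QuasiChar F).toMonoidHom))] : Fin 3 → (Fˣ →* ℂˣ)) a).comp (Matrix.GeneralLinearGroup.det.comp (Pi.evalMonoidHom (fun a : Fin 3 => GL {i : Fin 3 // (id : Fin 3 → Fin 3) i = a} F) a))) m : ℂˣ) : ℂ))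
      · rw [hζ]
        exact hz
      · exact h0r ζ hζ
    exact not_subsingleton _ (subsingleton_of_forall_weightSpace_eq_bot _ (K2E3GL3JacquetMultiplicityAdditive.commute_normalizedJacquetGL_id r.ρ) hall)
  -- parity
  haveI : IsTopologicalRing F := inferInstance
  have hb : IsOpen ((((η * ((unramifiedTwist F (1 / 2) : QuasiChar F).toMonoidHom))).ker : Subgroup Fˣ) : Set Fˣ) := isOpen_ker_b η hη
  have hirr2 := isIrreducible_parabolicIndGL_two_self (η * ((unramifiedTwist F (1 / 2) : QuasiChar F).toMonoidHom)) (continuous_unitsCoe_of_isOpen_ker _ hb)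
  obtain ⟨n, hn⟩ := even_finrank_weightSpace₁₂ r.ρ r.isSmooth (η * ((unramifiedTwist F (1 / 2) : QuasiChar F).toMonoidHom)⁻¹) (η * ((unramifiedTwist F (1 / 2) : QuasiChar F).toMonoidHom)) hb hirr2
  have hn' : finrank ℂ ↥(⨅ m, Module.End.maxGenEigenspace (Representation.normalizedJacquetGL F (id : Fin 3 → Fin 3) r.ρ m) (((∏ a : Fin 3, ((![(η * ((unramifiedTwist F (1 / 2) : QuasiChar F).toMonoidHom)⁻¹), (η * ((unramifiedTwist F (1 / 2) : QuasiChar F).toMonoidHom)), (η * ((unramifiedTwist F (1 / 2) : QuasiChar F).toMonoidHom))] : Fin 3 → (Fˣ →* ℂˣ)) a).comp (Matrix.GeneralLinearGroup.det.comp (Pi.evalMonoidHom (fun a : Fin 3 => GL {i : Fin 3 // (id : Fin 3 → Fin 3) i = a} F) a))) m : ℂˣ) : ℂ)) = n + n := hn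
  have hleX : finrank ℂ ↥(⨅ m, Module.End.maxGenEigenspace (Representation.normalizedJacquetGL F (id : Fin 3 → Fin 3) r.ρ m) (((∏ a : Fin 3, ((![(η * ((unramifiedTwist F (1 / 2) : QuasiChar F).toMonoidHom)⁻¹), (η * ((unramifiedTwist F (1 / 2) : QuasiChar F).toMonoidHom)), (η * ((unramifiedTwist F (1 / 2) : QuasiChar F).toMonoidHom))] : Fin 3 → (Fˣ →* ℂˣ)) a).comp (Matrix.GeneralLinearGroup.det.comp (Pi.evalMonoidHom (fun a : Fin 3 => GL {i : Fin 3 // (id : Fin 3 → Fin 3) i = a} F) a))) m : ℂˣ) : ℂ)) ≤ 2 := by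
    have h := hle (fun m : (Π a : Fin 3, GL {i : Fin 3 // (id : Fin 3 → Fin 3) i = a} F) => (((∏ a : Fin 3, ((![(η * ((unramifiedTwist F (1 / 2) : QuasiChar F).toMonoidHom)⁻¹), (η * ((unramifiedTwist F (1 / 2) : QuasiChar F).toMonoidHom)), (η * ((unramifiedTwist F (1 / 2) : QuasiChar F).toMonoidHom))] : Fin 3 → (Fˣ →* ℂˣ)) a).comp (Matrix.GeneralLinearGroup.det.comp (Pi.evalMonoidHom (fun a : Fin 3 => GL {i : Fin 3 // (id : Fin 3 → Fin 3) i = a} F) a))) m : ℂˣ) : ℂ))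
    beta_reduce at h
    have h' : finrank ℂ ↥(⨅ m, Module.End.maxGenEigenspace (Representation.normalizedJacquetGL F (id : Fin 3 → Fin 3) r.ρ m) (((∏ a : Fin 3, ((![(η * ((unramifiedTwist F (1 / 2) : QuasiChar F).toMonoidHom)⁻¹), (η * ((unramifiedTwist F (1 / 2) : QuasiChar F).toMonoidHom)), (η * ((unramifiedTwist F (1 / 2) : QuasiChar F).toMonoidHom))] : Fin 3 → (Fˣ →* ℂˣ)) a).comp (Matrix.GeneralLinearGroup.det.comp (Pi.evalMonoidHom (fun a : Fin 3 => GL {i : Fin 3 // (id : Fin 3 → Fin 3) i = a} F) a))) m : ℂˣ) : ℂ)) ≤ finrank ℂ ↥(⨅ m, Module.End.maxGenEigenspace (Representation.normalizedJacquetGL F (id : Fin 3 → Fin 3) V m) (((∏ a : Fin 3, ((![(η * ((unramifiedTwist F (1 / 2) : QuasiChar F).toMonoidHom)⁻¹), (η * ((unramifiedTwist F (1 / 2) : QuasiChar F).toMonoidHom)), (η * ((unramifiedTwist F (1 / 2) : QuasiChar F).toMonoidHom))] : Fin 3 → (Fˣ →* ℂˣ)) a).comp (Matrix.GeneralLinearGroup.det.comp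 (Pi.evalMonoidHom (fun a : Fin 3 => GL {i : Fin 3 // (id : Fin 3 → Fin 3) i = a} F) a))) m : ℂˣ) : ℂ)) := h
    omega
  omega

end Summit.HodgeConjecture.HodgeConjecture.Cruxes.H413.K2E3GL3OneLinkNestedHighConstituent

end
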